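import Mathlib
import Summits.Ventures.HodgeRepro.Tier4.Target

/-!
# Tier4/Line3/DecaySum — the depth sum `Σ_N q₁^N e^{−κ q^{N/d}}` converges (rung for L3.5)

Blind re-derivation cell `pub-hodge-repro`, Tier 4 «PROVE THE STEP» (README §9–§10), LINE L3, seat t4-L2-p3 on L3.5
`term_dominated` (lead S12234).

The class bound (`ClassBound.summand_bound_off_main`) makes every off-main summand at depth `N` a uniform majorant
times `e^{−κ (N(𝔭)^N)^{1/d}}`, and the tiling of the depth-`N` domain costs the index `≤ (q₀^d)^{9N}`
(`CongruenceIndex`).  The resulting depth sum `Σ_N q₁^N · e^{−κ ρ^N}` (`ρ = N(𝔭)^{1/d} > 1`) converges: `ρ^N ≥ N²`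
eventually, so the terms are `≤ (q₁ e^{−κN})^N ≤ 2^{−N}` eventually.

* `summable_pow_mul_exp_neg_pow` — `Summable (fun N => q₁^N · exp(−κ ρ^N))` for `0 ≤ q₁`, `1 < ρ`, `0 < κ`;
* `summable_pow_mul_exp_neg_root` — the same with `ρ^N` written as `(q^N)^{1/d}` (`1 < q`, `1 ≤ d`).

Nothing here asserts anything about the truth of (P); HC_CM is NOT proved by anyone in this repository.
-/

set_option autoImplicit false

namespace Summit.Ventures.HodgeRepro.Tier4.Line3

open Filter Topology

/-- **THE DEPTH SUM CONVERGES.** `Σ_N q₁^N e^{−κ ρ^N} < ∞` for `0 ≤ q₁`, `ρ > 1`, `κ > 0`. -/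
theorem summable_pow_mul_exp_neg_pow {q₁ ρ κ : ℝ} (hq₁ : 0 ≤ q₁) (hρ : 1 < ρ) (hκ : 0 < κ) :
    Summable (fun N : ℕ => q₁ ^ N * Real.exp (-(κ * ρ ^ N))) := by
  -- `ρ^N ≥ N²` eventually
  have h1 : ∀ᶠ N : ℕ in atTop, (N : ℝ) ^ 2 ≤ ρ ^ N := by
    have ht := tendsto_pow_const_div_const_pow_of_one_lt 2 hρ
    have hev := ht.eventually (eventually_le_nhds (by norm_num : (0 : ℝ) < 1))
    filter_upwards [hev] with N hN
    have hρN : 0 < ρ ^ N := pow_pos (by linarith) N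
    rwa [div_le_iff₀ hρN, one_mul] at hN
  -- `q₁ e^{−κ N} ≤ 1/2` eventually
  have h2 : ∀ᶠ N : ℕ in atTop, q₁ * Real.exp (-(κ * N)) ≤ 1 / 2 := by
    have ht : Tendsto (fun N : ℕ => q₁ * Real.exp (-(κ * N))) atTop (𝓝 (q₁ * 0)) := by
      refine Tendsto.const_mul q₁ ?_
      have : Tendsto (fun N : ℕ => -(κ * (N : ℝ))) atTop atBot := by
        have h := (tendsto_natCast_atTop_atTop (R := ℝ)).const_mul_atTop hκ
        exact tendsto_neg_atTop_atBot.comp h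
      exact Real.tendsto_exp_atBot.comp this
    rw [mul_zero] at ht
    exact ht.eventually (eventually_le_nhds (by norm_num : (0 : ℝ) < 1 / 2))
  refine Summable.of_norm_bounded_eventually_nat (g := fun N => (1 / 2 : ℝ) ^ N)
    (summable_geometric_of_lt_one (by norm_num) (by norm_num)) ?_
  filter_upwards [h1, h2] with N hN1 hN2
  rw [Real.norm_eq_abs, abs_of_nonneg (mul_nonneg (pow_nonneg hq₁ N) (Real.exp_pos _).le)]
  calc q₁ ^ N * Real.exp (-(κ * ρ ^ N)) ≤ q₁ ^ N * Real.exp (-(κ * (N : ℝ) ^ 2)) := by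
        refine mul_le_mul_of_nonneg_left (Real.exp_le_exp.mpr ?_) (pow_nonneg hq₁ N)
        nlinarith
    _ = (q₁ * Real.exp (-(κ * N))) ^ N := by
        rw [mul_pow, ← Real.exp_nat_mul]
        congr 2
        ring
    _ ≤ (1 / 2) ^ N := pow_le_pow_left₀ (mul_nonneg hq₁ (Real.exp_pos _).le) hN2 N

/-- The depth sum with the root written out: `Σ_N q₁^N e^{−κ (q^N)^{1/d}} < ∞` for `1 < q`, `1 ≤ d`. -/
theorem summable_pow_mul_exp_neg_root {q₁ q κ : ℝ} (hq₁ : 0 ≤ q₁) (hq : 1 < q) (hκ : 0 < κ) {d : ℕ} (hd : 1 ≤ d) :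
    Summable (fun N : ℕ => q₁ ^ N * Real.exp (-(κ * ((q ^ N) ^ ((d : ℝ)⁻¹))))) := by
  have hρ : 1 < q ^ ((d : ℝ)⁻¹) := Real.one_lt_rpow hq (by positivity)
  have heq : ∀ N : ℕ, (q ^ N) ^ ((d : ℝ)⁻¹) = (q ^ ((d : ℝ)⁻¹)) ^ N := fun N => by
    rw [← Real.rpow_natCast, ← Real.rpow_mul (by linarith), mul_comm, Real.rpow_mul (by linarith),
      Real.rpow_natCast]
  simp only [heq]
  exact summable_pow_mul_exp_neg_pow hq₁ hρ hκ

end Summit.Ventures.HodgeRepro.Tier4.Line3
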